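/-
Origin: expansion seat `planner-pub-hodgecm-toy-0`, handover #2 2026-08-18T04:13:45Z (`HOME/pub-hodgecm-toy/lean/Toy/Objects.lean`, md5 bcd8dd70, 321 lines);
landed by the gen-5 packager in gate run 21 as `HodgeCM/Model/Toy/Objects.lean` (import ^import Toy\.→import HodgeCM.Model.Toy. ×2).
-/
-- HANDOVER (planner-pub-hodgecm-toy-0, unit pub-hodgecm-toy): WIP module `Toy.Objects`; intended final module
-- `HodgeCM.Model.Toy.Objects` (kind L5, toy model / consistency witness); rename `import Toy.X` ↦ the final prefix.
/-
Copyright: pub-hodgecm cell (HodgeCMPerL). Consistency-witness layer (part (e), referee A G4).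

# Objects and morphisms of the toy model

An object ("variety") of the toy universe is a finite family of **CM atoms** — a number field presented
as a finite-dimensional subfield `F ⊆ ℂ` together with a set `Φ` of complex embeddings of `F` (its CM type) —
plus a tag `extra : ℕ` (extra dimension, used only by the Picard-modular-surface object).
Its "`H¹`-lattice" is the `ℚ`-space `L X = Π_i F_i`; its complexification carries the eigenvectors
`eT X i τ` (`τ : F_i →+* ℂ`) and the "holomorphic" subspace `F1 X = span {eT X i τ | τ ∈ Φ_i}`.
A morphism `X ⟶ Y` is a `ℚ`-linear map `L Y → L X` (think: pull-back on `H¹`) mapping `F1 Y` into `F1 X`.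
Since `Universe.Var : Type`, atoms cannot store an abstract `K : CMField` (which lives in `Type 1`):
a CM field `K` is presented by the subfield `FK K = σ₀(K) ⊆ ℂ` of a chosen embedding, `eK : K ≃ₐ[ℚ] FK K`.
-/
import Mathlib
import Summits.HodgeConjecture.HodgeCM.Geometry.Facts
import Summits.HodgeConjecture.HodgeCM.Model.Toy.CMIdempotent
import Summits.HodgeConjecture.HodgeCM.Model.Toy.Exterior

namespace HodgeCM.Toy

open Literature.AlgebraicGeometry.Motives
open scoped TensorProduct

noncomputable section

/-! ### Type-0 codes for finite index types -/

/-- Codes for the index types of atoms: closed under binary sums (products of varieties). -/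
inductive Shape : Type
  | empty : Shape
  | unit : Shape
  | sum : Shape → Shape → Shape

namespace Shape

/-- Decoding a code to a (finite) type. -/
@[reducible] def toType : Shape → Type
  | empty => Empty
  | unit => Unit
  | sum a b => toType a ⊕ toType b

/-- (Ported verbatim from the HodgeCMPerL package; no docstring in the source.) -/
instance instFintype : (s : Shape) → Fintype s.toType
  | empty => inferInstanceAs (Fintype Empty)
  | unit => inferInstanceAs (Fintype Unit)
  | sum a b => @instFintypeSum _ _ (instFintype a) (instFintype b)

/-- (Ported verbatim from the HodgeCMPerL package; no docstring in the source.) -/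
instance instDecidableEq : (s : Shape) → DecidableEq s.toType
  | empty => inferInstanceAs (DecidableEq Empty)
  | unit => inferInstanceAs (DecidableEq Unit)
  | sum a b => letI := instDecidableEq a; letI := instDecidableEq b
               inferInstanceAs (DecidableEq (toType a ⊕ toType b))

/-- A **reducible** case split on a sum (so that the atoms of a product compute by `rfl`). -/
@[reducible] def sumElim {A B C : Type} (f : A → C) (g : B → C) : A ⊕ B → C
  | .inl a => f a
  | .inr b => g b

end Shape

/-! ### Atoms and objects -/

/-- A **CM atom**: a finite-dimensional subfield of `ℂ` with a set of complex embeddings. -/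
structure Atom : Type where
  /-- the field, presented inside `ℂ` -/
  F : IntermediateField ℚ ℂ
  [fin : FiniteDimensional ℚ F]
  /-- the "CM type": the embeddings declared holomorphic -/
  Φ : Set (F →+* ℂ)
  /-- `Φ` is a CM type: it contains exactly one of each pair of complex-conjugate embeddings -/
  cm : ∀ τ : F →+* ℂ, τ ∈ Φ ↔ NumberField.ComplexEmbedding.conjugate τ ∉ Φ

attribute [instance] Atom.fin

/-- (Ported verbatim from the HodgeCMPerL package; no docstring in the source.) -/
instance (A : Atom) : NumberField A.F := NumberField.mk

/-- An **object** of the toy universe: a `Shape`-indexed family of atoms and an extra-dimension tag. -/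
structure Obj : Type where
  s : Shape
  atom : s.toType → Atom
  extra : ℕ

namespace Obj

variable (X Y Z : Obj)

/-- The `H¹`-lattice `L X = Π_i F_i` (a finite-dimensional `ℚ`-space). -/
abbrev L : Type := (i : X.s.toType) → (X.atom i).F

/-- Its complexification. -/
abbrev LC : Type := ℂ ⊗[ℚ] X.L

/-- The eigenvector `eT X i τ = (0,…, eps τ ,…,0) ∈ ℂ ⊗ L X`. -/
def eT (i : X.s.toType) (τ : (X.atom i).F →+* ℂ) : X.LC :=
  (LinearMap.single ℚ (fun j => ((X.atom j).F : Type)) i).baseChange ℂ (eps (X.atom i).F τ)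

/-- The holomorphic subspace `F¹ ⊆ ℂ ⊗ L X`: span of the eigenvectors of holomorphic type. -/
def F1 : Submodule ℂ X.LC :=
  Submodule.span ℂ {x | ∃ (i : X.s.toType) (τ : (X.atom i).F →+* ℂ), τ ∈ (X.atom i).Φ ∧ x = X.eT i τ}

variable {X Y Z}

/-- A `ℚ`-linear map of lattices is **Hodge** if its complexification maps `F¹` into `F¹`. -/
def IsHodge (φ : Y.L →ₗ[ℚ] X.L) : Prop := (Y.F1).map (φ.baseChange ℂ) ≤ X.F1

/-- (Ported verbatim from the HodgeCMPerL package; no docstring in the source.) -/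
lemma isHodge_iff (φ : Y.L →ₗ[ℚ] X.L) :
    IsHodge φ ↔ ∀ (i : Y.s.toType) (τ : (Y.atom i).F →+* ℂ), τ ∈ (Y.atom i).Φ →
      φ.baseChange ℂ (Y.eT i τ) ∈ X.F1 := by
  constructor
  · intro h i τ hτ
    exact h (Submodule.mem_map_of_mem (Submodule.subset_span ⟨i, τ, hτ, rfl⟩))
  · intro h
    rw [IsHodge, F1, Submodule.map_span_le]
    rintro _ ⟨i, τ, hτ, rfl⟩
    exact h i τ hτ

/-- (Ported verbatim from the HodgeCMPerL package; no docstring in the source.) -/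
lemma IsHodge.id : IsHodge (LinearMap.id : X.L →ₗ[ℚ] X.L) := by
  simp [IsHodge, LinearMap.baseChange_id]

/-- (Ported verbatim from the HodgeCMPerL package; no docstring in the source.) -/
lemma IsHodge.comp {φ : Y.L →ₗ[ℚ] X.L} {ψ : Z.L →ₗ[ℚ] Y.L} (hφ : IsHodge φ) (hψ : IsHodge ψ) :
    IsHodge (φ ∘ₗ ψ) := by
  unfold IsHodge at *
  rw [LinearMap.baseChange_comp, Submodule.map_comp]
  exact (Submodule.map_mono hψ).trans hφ

variable (X Y Z)

/-- Morphisms `X ⟶ Y` of the toy universe: Hodge `ℚ`-linear maps `L Y → L X` ("pull-backs on `H¹`"). -/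
structure Hom : Type where
  /-- the pull-back on the `H¹`-lattices -/
  lin : Y.L →ₗ[ℚ] X.L
  hodge : IsHodge lin

variable {X Y Z}

/-- (Ported verbatim from the HodgeCMPerL package; no docstring in the source.) -/
@[ext] lemma Hom.ext {f g : Hom X Y} (h : f.lin = g.lin) : f = g := by
  cases f; cases g; congr

/-- identity -/
def Hom.id (X : Obj) : Hom X X := ⟨LinearMap.id, IsHodge.id⟩

/-- composition in diagrammatic order (`comp f g = g ∘ f`, so pull-backs compose the other way) -/
def Hom.comp (f : Hom X Y) (g : Hom Y Z) : Hom X Z := ⟨f.lin ∘ₗ g.lin, f.hodge.comp g.hodge⟩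

/-! ### Products -/

variable (X Y)

/-- product object: disjoint union of the atom families -/
@[reducible] def prod : Obj := ⟨X.s.sum Y.s, Shape.sumElim X.atom Y.atom, X.extra + Y.extra⟩

/-- `L (X × Y) ≃ L X × L Y` -/
def sumEquiv : (X.prod Y).L ≃ₗ[ℚ] X.L × Y.L :=
  LinearEquiv.sumPiEquivProdPi ℚ X.s.toType Y.s.toType (fun st => ((Shape.sumElim X.atom Y.atom st).F : Type))

/-- pull-back along the first projection: `L X → L (X × Y)` -/
def inlL : X.L →ₗ[ℚ] (X.prod Y).L := (X.sumEquiv Y).symm.toLinearMap ∘ₗ LinearMap.inl ℚ X.L Y.L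

/-- pull-back along the second projection: `L Y → L (X × Y)` -/
def inrL : Y.L →ₗ[ℚ] (X.prod Y).L := (X.sumEquiv Y).symm.toLinearMap ∘ₗ LinearMap.inr ℚ X.L Y.L

variable {X Y}

/-- (Ported verbatim from the HodgeCMPerL package; no docstring in the source.) -/
@[simp] lemma sumEquiv_apply_fst (v : (X.prod Y).L) (i : X.s.toType) :
    (X.sumEquiv Y v).1 i = v (Sum.inl i) := rfl

/-- (Ported verbatim from the HodgeCMPerL package; no docstring in the source.) -/
@[simp] lemma sumEquiv_apply_snd (v : (X.prod Y).L) (i : Y.s.toType) :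
    (X.sumEquiv Y v).2 i = v (Sum.inr i) := rfl

/-- (Ported verbatim from the HodgeCMPerL package; no docstring in the source.) -/
lemma inlL_apply_inl (x : X.L) (i : X.s.toType) : X.inlL Y x (Sum.inl i) = x i := by
  have := sumEquiv_apply_fst ((X.sumEquiv Y).symm (x, 0)) i
  rw [LinearEquiv.apply_symm_apply] at this
  exact this.symm

/-- (Ported verbatim from the HodgeCMPerL package; no docstring in the source.) -/
lemma inlL_apply_inr (x : X.L) (i : Y.s.toType) : X.inlL Y x (Sum.inr i) = 0 := by
  have := sumEquiv_apply_snd ((X.sumEquiv Y).symm (x, 0)) i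
  rw [LinearEquiv.apply_symm_apply] at this
  exact this.symm

/-- (Ported verbatim from the HodgeCMPerL package; no docstring in the source.) -/
lemma inrL_apply_inl (y : Y.L) (i : X.s.toType) : X.inrL Y y (Sum.inl i) = 0 := by
  have := sumEquiv_apply_fst ((X.sumEquiv Y).symm (0, y)) i
  rw [LinearEquiv.apply_symm_apply] at this
  exact this.symm

/-- (Ported verbatim from the HodgeCMPerL package; no docstring in the source.) -/
lemma inrL_apply_inr (y : Y.L) (i : Y.s.toType) : X.inrL Y y (Sum.inr i) = y i := by
  have := sumEquiv_apply_snd ((X.sumEquiv Y).symm (0, y)) i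
  rw [LinearEquiv.apply_symm_apply] at this
  exact this.symm

/-- `inl ∘ single i = single (inl i)` -/
lemma inlL_comp_single (i : X.s.toType) :
    X.inlL Y ∘ₗ LinearMap.single ℚ (fun j => ((X.atom j).F : Type)) i
      = LinearMap.single ℚ (fun j => (((X.prod Y).atom j).F : Type)) (Sum.inl i) := by
  refine LinearMap.ext fun y => funext fun j => ?_
  change X.inlL Y (Pi.single i y) j = Pi.single (M := fun j => (((X.prod Y).atom j).F : Type)) (Sum.inl i) y j
  rcases j with j | j
  · rw [inlL_apply_inl]
    by_cases h : j = i
    · subst h; rw [Pi.single_eq_same, Pi.single_eq_same]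
    · rw [Pi.single_eq_of_ne h, Pi.single_eq_of_ne (Sum.inl_injective.ne h)]
  · rw [inlL_apply_inr, Pi.single_eq_of_ne Sum.inr_ne_inl]

/-- (Ported verbatim from the HodgeCMPerL package; no docstring in the source.) -/
lemma inrL_comp_single (i : Y.s.toType) :
    X.inrL Y ∘ₗ LinearMap.single ℚ (fun j => ((Y.atom j).F : Type)) i
      = LinearMap.single ℚ (fun j => (((X.prod Y).atom j).F : Type)) (Sum.inr i) := by
  refine LinearMap.ext fun y => funext fun j => ?_
  change X.inrL Y (Pi.single i y) j = Pi.single (M := fun j => (((X.prod Y).atom j).F : Type)) (Sum.inr i) y j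
  rcases j with j | j
  · rw [inrL_apply_inl, Pi.single_eq_of_ne Sum.inl_ne_inr]
  · rw [inrL_apply_inr]
    by_cases h : j = i
    · subst h; rw [Pi.single_eq_same, Pi.single_eq_same]
    · rw [Pi.single_eq_of_ne h, Pi.single_eq_of_ne (Sum.inr_injective.ne h)]

/-- (Ported verbatim from the HodgeCMPerL package; no docstring in the source.) -/
lemma sumEquiv_single_inl (i : X.s.toType) (y : (X.atom i).F) :
    X.sumEquiv Y (Pi.single (M := fun j => (((X.prod Y).atom j).F : Type)) (Sum.inl i) y)
      = (Pi.single i y, 0) := by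
  refine Prod.ext (funext fun j => ?_) (funext fun j => ?_)
  · change Pi.single (M := fun j => (((X.prod Y).atom j).F : Type)) (Sum.inl i) y (Sum.inl j) = Pi.single (M := fun j => ((X.atom j).F : Type)) i y j
    by_cases h : j = i
    · subst h; rw [Pi.single_eq_same, Pi.single_eq_same]
    · rw [Pi.single_eq_of_ne h, Pi.single_eq_of_ne (Sum.inl_injective.ne h)]
  · change Pi.single (M := fun j => (((X.prod Y).atom j).F : Type)) (Sum.inl i) y (Sum.inr j) = 0
    rw [Pi.single_eq_of_ne Sum.inr_ne_inl]

/-- (Ported verbatim from the HodgeCMPerL package; no docstring in the source.) -/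
lemma sumEquiv_single_inr (i : Y.s.toType) (y : (Y.atom i).F) :
    X.sumEquiv Y (Pi.single (M := fun j => (((X.prod Y).atom j).F : Type)) (Sum.inr i) y)
      = (0, Pi.single i y) := by
  refine Prod.ext (funext fun j => ?_) (funext fun j => ?_)
  · change Pi.single (M := fun j => (((X.prod Y).atom j).F : Type)) (Sum.inr i) y (Sum.inl j) = 0
    rw [Pi.single_eq_of_ne Sum.inl_ne_inr]
  · change Pi.single (M := fun j => (((X.prod Y).atom j).F : Type)) (Sum.inr i) y (Sum.inr j) = Pi.single (M := fun j => ((Y.atom j).F : Type)) i y j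
    by_cases h : j = i
    · subst h; rw [Pi.single_eq_same, Pi.single_eq_same]
    · rw [Pi.single_eq_of_ne h, Pi.single_eq_of_ne (Sum.inr_injective.ne h)]

/-- (Ported verbatim from the HodgeCMPerL package; no docstring in the source.) -/
lemma baseChange_inlL_eT (i : X.s.toType) (τ : (X.atom i).F →+* ℂ) :
    (X.inlL Y).baseChange ℂ (X.eT i τ) = (X.prod Y).eT (Sum.inl i) τ := by
  simp only [eT, ← LinearMap.comp_apply, ← LinearMap.baseChange_comp, inlL_comp_single]

/-- (Ported verbatim from the HodgeCMPerL package; no docstring in the source.) -/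
lemma baseChange_inrL_eT (i : Y.s.toType) (τ : (Y.atom i).F →+* ℂ) :
    (X.inrL Y).baseChange ℂ (Y.eT i τ) = (X.prod Y).eT (Sum.inr i) τ := by
  simp only [eT, ← LinearMap.comp_apply, ← LinearMap.baseChange_comp, inrL_comp_single]

/-- (Ported verbatim from the HodgeCMPerL package; no docstring in the source.) -/
lemma isHodge_inlL : IsHodge (X.inlL Y) := by
  rw [isHodge_iff]
  intro i τ hτ
  rw [baseChange_inlL_eT]
  exact Submodule.subset_span ⟨Sum.inl i, τ, hτ, rfl⟩

/-- (Ported verbatim from the HodgeCMPerL package; no docstring in the source.) -/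
lemma isHodge_inrL : IsHodge (X.inrL Y) := by
  rw [isHodge_iff]
  intro i τ hτ
  rw [baseChange_inrL_eT]
  exact Submodule.subset_span ⟨Sum.inr i, τ, hτ, rfl⟩

variable (X Y)

/-- first projection `X × Y ⟶ X` -/
def fst : Hom (X.prod Y) X := ⟨X.inlL Y, isHodge_inlL⟩
/-- second projection `X × Y ⟶ Y` -/
def snd : Hom (X.prod Y) Y := ⟨X.inrL Y, isHodge_inrL⟩

variable {X Y}

/-- the universal morphism `Z ⟶ X × Y` -/
def lift (f : Hom Z X) (g : Hom Z Y) : Hom Z (X.prod Y) where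
  lin := (f.lin.coprod g.lin) ∘ₗ (X.sumEquiv Y).toLinearMap
  hodge := by
    rw [isHodge_iff]
    rintro (i | i) τ hτ
    · have h1 : ((f.lin.coprod g.lin) ∘ₗ (X.sumEquiv Y).toLinearMap) ∘ₗ
          LinearMap.single ℚ (fun j => (((X.prod Y).atom j).F : Type)) (Sum.inl i)
          = f.lin ∘ₗ LinearMap.single ℚ (fun j => ((X.atom j).F : Type)) i := by
        refine LinearMap.ext fun y => ?_
        simp only [LinearMap.coe_comp, Function.comp_apply, LinearEquiv.coe_coe, LinearMap.coe_single]
        rw [sumEquiv_single_inl]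
        simp
      have : ((f.lin.coprod g.lin) ∘ₗ (X.sumEquiv Y).toLinearMap).baseChange ℂ ((X.prod Y).eT (Sum.inl i) τ)
          = f.lin.baseChange ℂ (X.eT i τ) := by
        change (((f.lin.coprod g.lin) ∘ₗ (X.sumEquiv Y).toLinearMap).baseChange ℂ ∘ₗ
            (LinearMap.single ℚ (fun j => (((X.prod Y).atom j).F : Type)) (Sum.inl i)).baseChange ℂ) (eps _ τ)
          = (f.lin.baseChange ℂ ∘ₗ (LinearMap.single ℚ (fun j => ((X.atom j).F : Type)) i).baseChange ℂ) (eps _ τ)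
        rw [← LinearMap.baseChange_comp, ← LinearMap.baseChange_comp, h1]
      rw [this]
      exact (isHodge_iff _).mp f.hodge i τ hτ
    · have h1 : ((f.lin.coprod g.lin) ∘ₗ (X.sumEquiv Y).toLinearMap) ∘ₗ
          LinearMap.single ℚ (fun j => (((X.prod Y).atom j).F : Type)) (Sum.inr i)
          = g.lin ∘ₗ LinearMap.single ℚ (fun j => ((Y.atom j).F : Type)) i := by
        refine LinearMap.ext fun y => ?_
        simp only [LinearMap.coe_comp, Function.comp_apply, LinearEquiv.coe_coe, LinearMap.coe_single]
        rw [sumEquiv_single_inr]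
        simp
      have : ((f.lin.coprod g.lin) ∘ₗ (X.sumEquiv Y).toLinearMap).baseChange ℂ ((X.prod Y).eT (Sum.inr i) τ)
          = g.lin.baseChange ℂ (Y.eT i τ) := by
        change (((f.lin.coprod g.lin) ∘ₗ (X.sumEquiv Y).toLinearMap).baseChange ℂ ∘ₗ
            (LinearMap.single ℚ (fun j => (((X.prod Y).atom j).F : Type)) (Sum.inr i)).baseChange ℂ) (eps _ τ)
          = (g.lin.baseChange ℂ ∘ₗ (LinearMap.single ℚ (fun j => ((Y.atom j).F : Type)) i).baseChange ℂ) (eps _ τ)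
        rw [← LinearMap.baseChange_comp, ← LinearMap.baseChange_comp, h1]
      rw [this]
      exact (isHodge_iff _).mp g.hodge i τ hτ

/-- (Ported verbatim from the HodgeCMPerL package; no docstring in the source.) -/
lemma lift_comp_fst (f : Hom Z X) (g : Hom Z Y) : (lift f g).comp (X.fst Y) = f := by
  apply Hom.ext
  simp only [Hom.comp, lift, fst, inlL]
  rw [LinearMap.comp_assoc, ← LinearMap.comp_assoc _ _ (X.sumEquiv Y).toLinearMap]
  simp

/-- (Ported verbatim from the HodgeCMPerL package; no docstring in the source.) -/
lemma lift_comp_snd (f : Hom Z X) (g : Hom Z Y) : (lift f g).comp (X.snd Y) = g := by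
  apply Hom.ext
  simp only [Hom.comp, lift, snd, inrL]
  rw [LinearMap.comp_assoc, ← LinearMap.comp_assoc _ _ (X.sumEquiv Y).toLinearMap]
  simp

end Obj

end

end HodgeCM.Toy
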